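import Mathlib
import HarnessLib
import Summits.ResolutionOfSingularities.ResolutionOfSingularities.Theorems.WildQuotientsWildQuotientResolutionToricExitCover
import Summits.ResolutionOfSingularities.ResolutionOfSingularities.Theorems.WildQuotientsWildQuotientResolutionZ9PeeledCoverThree
import Summits.ResolutionOfSingularities.ResolutionOfSingularities.Theorems.WildQuotientsWildQuotientResolutionZ9PeeledConjCharts

/-!
# ℤ9 SPECIMEN (peeled `𝔸⁴/ℤ9`, char 3), brick Z3 part 2b: the STABLE cover
# `P₀ ∪ P_T ∪ P₂ = V` of `V = Bl_{I₂₈} 𝔸ⁿ` by orbit intersections of the vertex charts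
(crux stmt-ResolutionOfSingularities-15640 `WildQuotients.WildQuotientResolution`, line `Sketch`; S1 =
stmt-ResolutionOfSingularities-17941 `CyclicQuotientFourfolds`, non-linear sector; chain w45c card P specimen
«peeled 𝔸⁴/ℤ9» — res-L1-w45c-idea-2 memo `L/res-L1-w45c-idea-2/cardP_g12/Z9-SPECIMEN.md` §2 «COVER BY STABLE
PIECES» / §4 brick Z3 and `cardP_g12/Z4T-TWIST.md` §1 (`P_T = D₊(N₁⁷t³) = D₊(x_b⁷t) ∩ {u invertible}`),
res-L1-w45c-plan-1 GO 2026-08-27T16:29:20Z, CLARIFICATION 16:29:52Z, ORDER 16:36:47Z («use exactly that piece …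
post the three piece NAMES»). [OURS · L1 W4.5c] — NOT a statement of any manuscript; replaces the role of no
printed item; AI-produced, weaker than expert review. Def-free. Prover res-D-pv-033.)

`V = Bl_{I₂₈} 𝔸ⁿ = Proj k[x][I₂₈ t]` for the abstract generator vector `g : Fin 24 → k[x]` with the exponent table
of record (`…Z9PeeledI28Stable`), `σ̄ x_a = x_a`, `σ̄ x_b = x_b + x_a` (letters `h0 hb`; the laws on `x_c`, `x_d`
and the passengers are not used here), `ρ` any action of `⟨σ̄⟩` on `𝔸ⁿ` with the affine-quotient law, `hJ`
ABSTRACT, `L γ := (affineBlowup.isBlowup I₂₈).liftAction ρ hJ γ` the lifted action. THE THREE PIECES OF RECORD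
(names for Z4a / Z4T / Z4b / Z5 / Z6 consumers; all three are `⟨σ̄⟩`-stable affine opens of `V`):
* `P₀ := D₊(g 0 · t) = D₊(x_a⁴ t)` — the `μ₇`-vertex chart, stable by itself (`…CoverThree`,
  `preimage_vertexChartA_eq`; Proj spelling `preimage_vertexChartA_eq'` below);
* `P_T := ⨅ γ, (L γ)⁻¹ D₊(g 16 · t)` — the orbit intersection of the `μ₄`-vertex chart `D₊(x_b⁷t)`; by
  `preimage_vertexChartB_eq` it is `D₊(x_b⁷t) ∩ D₊((x_b+x_a)⁷t) ∩ D₊((x_b−x_a)⁷t) = D₊(N₁⁷ t³)` (idea-2's piece;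
  the identification as ONE basic open of the invariant norm element is in the Z4-files that need it);
* `P₂ := ⨅ γ, (L γ)⁻¹ D₊(g 23 · t)` — the orbit intersection of the smooth vertex chart `D₊(x_c²⁸t)`
  (`= D₊(N₂²⁸ t³)`, `N₂ = x_c·σ̄x_c·σ̄²x_c`, likewise).
Stability and affineness of `P_T`, `P₂` are the tree's generic `ToricExit.preimage_iInf_preimage_eq` /
`IsAffineOpen.iInf` (`pieceT_stable`, `isAffineOpen_pieceT`, …).

THE STABLE COVER **`vertexChartA_sup_pieceT_sup_pieceC_eq_top : P₀ ⊔ P_T ⊔ P₂ = ⊤`** — by the vertex cover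
(`iSup_vertexCharts_eq_top`, part 1) and ONE cheap Rees identity: for `γ ∈ ⟨σ̄⟩`, `γ⁻¹·x_b = x_b + m x_a`
(`exists_smul_X_b_eq`), the transported chart is `(L γ)⁻¹ D₊(x_b⁷t) = D₊((x_b + m x_a)⁷ t)`
(`BlowupExit.preimage_basicOpen_reesT_liftAction`, generic: `(L γ)⁻¹ D₊(bt) = D₊((γ⁻¹·b)t)`), and on the
complement of `P₀` (`x_a⁴t ∈ 𝔭`) one has `(x_b + m x_a)⁷ t ≡ x_b⁷ t (mod 𝔭)`
(`(x_b + m x_a)⁷ = x_b⁷ + 7m·x_ax_b⁶ + 21m²x_b·x_a²x_b⁴ + 35m³x_b²·x_a³x_b² + (…)·x_a⁴` with `x_ax_b⁶t`,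
`x_a²x_b⁴t`, `x_a³x_b²t ∈ 𝔭` from `(x_a³x_b²t)² = (x_a⁴t)(x_a²x_b⁴t)`, `(x_a²x_b⁴t)² = (x_a⁴t)(x_b⁷·x_b t)`,
`(x_ax_b⁶t)⁴ = (x_a⁴t)(x_b⁷t)³x_b³`; `mem_basicOpen_conj_iff`). Hence off `P₀`: a point of `D₊(x_b⁷t)` has its
whole orbit there (`⇒ P_T`), and a point outside `D₊(x_b⁷t)` has its whole orbit outside `P₀ ∪ D₊(x_b⁷t)`,
i.e. inside `D₊(x_c²⁸t)` (`⇒ P₂`). No degree-`28` expansion is needed.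
-/

-- single-problem summit: the doubled namespace component `ResolutionOfSingularities` is forced
set_option linter.dupNamespace false

noncomputable section

open CategoryTheory AlgebraicGeometry TopologicalSpace MvPolynomial Polynomial
open scoped Pointwise
open Literature.AlgebraicGeometry.Resolution

namespace Summit.ResolutionOfSingularities.ResolutionOfSingularities.Theorems.WildQuotientResolution

namespace Z9Peeled

variable (k : Type) [Field k] (n : ℕ) (a b c : Fin n)

/-- The exponent table of the 24 generators of `I₂₈` (memo §1 order; local shorthand used only inside theorem
signatures). -/
local notation3 "e24" => (![(4, 0, 0), (3, 2, 0), (3, 1, 3), (3, 0, 7), (2, 4, 0), (2, 3, 2), (2, 2, 6), (2, 1, 10), (2, 0, 14), (1, 6, 0), (1, 5, 1), (1, 4, 5), (1, 3, 9), (1, 2, 13), (1, 1, 17), (1, 0, 21), (0, 7, 0), (0, 6, 4), (0, 5, 8), (0, 4, 12), (0, 3, 16), (0, 2, 20), (0, 1, 24), (0, 0, 28)] : Fin 24 → ℕ × ℕ × ℕ)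

/-! ## The pieces and the stable cover -/

/-- Membership in an infimum of opens. [folklore] -/
theorem mem_iInf_opens {X : Type*} [TopologicalSpace X] {ι : Type*} [Finite ι] (U : ι → Opens X)
    (x : X) : x ∈ (⨅ i, U i) ↔ ∀ i, x ∈ U i := by
  rw [← SetLike.mem_coe, Opens.coe_iInf, Set.mem_iInter]
  rfl

section Cover

variable (g : Fin 24 → MvPolynomial (Fin n) k)
  (σ : MvPolynomial (Fin n) k ≃ₐ[k] MvPolynomial (Fin n) k)

/-- the Rees generator `g_j t` -/
local notation3 (prettyPrint := false) "gT" j =>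
  reesT (I := Ideal.span (Set.range g)) (g j) (Ideal.mem_span_range_self (f := g) (x := j))
/-- the vertex chart `D₊(g_j t)` -/
local notation3 (prettyPrint := false) "D₊" j =>
  Proj.basicOpen (reesGrading (Ideal.span (Set.range g))) (gT j)

/-- **Transport of the `μ₄`-vertex chart**: `(L γ)⁻¹ D₊(x_b⁷ t) = D₊((x_b + m x_a)⁷ t)` with the `m` of
`γ⁻¹ • x_b = x_b + m x_a`. [folklore] -/
theorem exists_preimage_vertexChartB_eq (h0 : σ (X a) = X a) (hb : σ (X b) = X b + X a)
    (hg : ∀ q, g q = X a ^ (e24 q).1 * X b ^ (e24 q).2.1 * X c ^ (e24 q).2.2)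
    (ρ : ↥(Subgroup.zpowers σ) →* Aut (Spec (CommRingCat.of (MvPolynomial (Fin n) k))))
    (hρ : ∀ γ : ↥(Subgroup.zpowers σ), (ρ γ).hom = Spec.map (CommRingCat.ofHom
      ((MulSemiringAction.toRingEquiv (↥(Subgroup.zpowers σ)) (MvPolynomial (Fin n) k) γ⁻¹ :
        MvPolynomial (Fin n) k ≃+* MvPolynomial (Fin n) k) :
          MvPolynomial (Fin n) k →+* MvPolynomial (Fin n) k)))
    (hJ : ∀ γ : ↥(Subgroup.zpowers σ),
      (affineBlowup.idealSheaf (Ideal.span (Set.range g))).comap (ρ γ).hom =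
        affineBlowup.idealSheaf (Ideal.span (Set.range g)))
    (γ : ↥(Subgroup.zpowers σ)) :
    ∃ m : k, (((affineBlowup.isBlowup (Ideal.span (Set.range g))).liftAction ρ hJ) γ).hom ⁻¹ᵁ (D₊ 16) =
      Proj.basicOpen (reesGrading (Ideal.span (Set.range g)))
        (reesT ((X b + MvPolynomial.C m * X a : MvPolynomial (Fin n) k) ^ 7) (add_C_mul_pow_seven_mem k n a b c g hg m)) := by
  obtain ⟨m, hm⟩ := exists_inv_smul_g16_eq k n a b c σ h0 hb g hg γ
  refine ⟨m, ?_⟩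
  have hmem : γ⁻¹ • g 16 ∈ Ideal.span (Set.range g) := by
    rw [hm]; exact add_C_mul_pow_seven_mem k n a b c g hg m
  rw [BlowupExit.preimage_basicOpen_reesT_liftAction ρ hρ hJ _ γ hmem]
  have key : ∀ (u : MvPolynomial (Fin n) k) (hu : u ∈ Ideal.span (Set.range g)) (e : u = (X b + MvPolynomial.C m * X a) ^ 7),
      Proj.basicOpen (reesGrading (Ideal.span (Set.range g))) (reesT u hu) =
        Proj.basicOpen (reesGrading (Ideal.span (Set.range g)))
          (reesT ((X b + MvPolynomial.C m * X a : MvPolynomial (Fin n) k) ^ 7) (add_C_mul_pow_seven_mem k n a b c g hg m)) := by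
    rintro u hu rfl; rfl
  exact key _ hmem hm

/-- **`P₀ = D₊(x_a⁴t)` is stable** (Proj spelling of `preimage_vertexChartA_eq`). [folklore] -/
theorem preimage_vertexChartA_eq' (h0 : σ (X a) = X a)
    (hg : ∀ q, g q = X a ^ (e24 q).1 * X b ^ (e24 q).2.1 * X c ^ (e24 q).2.2)
    (ρ : ↥(Subgroup.zpowers σ) →* Aut (Spec (CommRingCat.of (MvPolynomial (Fin n) k))))
    (hρ : ∀ γ : ↥(Subgroup.zpowers σ), (ρ γ).hom = Spec.map (CommRingCat.ofHom
      ((MulSemiringAction.toRingEquiv (↥(Subgroup.zpowers σ)) (MvPolynomial (Fin n) k) γ⁻¹ :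
        MvPolynomial (Fin n) k ≃+* MvPolynomial (Fin n) k) :
          MvPolynomial (Fin n) k →+* MvPolynomial (Fin n) k)))
    (hJ : ∀ γ : ↥(Subgroup.zpowers σ),
      (affineBlowup.idealSheaf (Ideal.span (Set.range g))).comap (ρ γ).hom =
        affineBlowup.idealSheaf (Ideal.span (Set.range g)))
    (γ : ↥(Subgroup.zpowers σ)) :
    (((affineBlowup.isBlowup (Ideal.span (Set.range g))).liftAction ρ hJ) γ).hom ⁻¹ᵁ (D₊ 0) = (D₊ 0) := by
  have hfix : γ⁻¹ • g 0 = g 0 := smul_g0_eq k n a b c σ h0 g hg γ⁻¹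
  have hmem : γ⁻¹ • g 0 ∈ Ideal.span (Set.range g) := by rw [hfix]; exact Ideal.mem_span_range_self
  rw [BlowupExit.preimage_basicOpen_reesT_liftAction ρ hρ hJ _ γ hmem]
  have key : ∀ (u : MvPolynomial (Fin n) k) (hu : u ∈ Ideal.span (Set.range g)) (e : u = g 0),
      Proj.basicOpen (reesGrading (Ideal.span (Set.range g))) (reesT u hu) = (D₊ 0) := by
    rintro u hu rfl; rfl
  exact key _ hmem hfix

variable [Finite ↥(Subgroup.zpowers σ)]

/-- **THE STABLE COVER `P₀ ∪ P_T ∪ P₂ = V`** of `V = Bl_{I₂₈} 𝔸ⁿ` (`⟨σ̄⟩` finite, as in every scaffold): the `μ₇`-vertex chart, the orbit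
intersection of the `μ₄`-vertex chart and the orbit intersection of the smooth vertex chart cover `V`.
[OURS · L1 W4.5c] [folklore] -/
theorem vertexChartA_sup_pieceT_sup_pieceC_eq_top (h0 : σ (X a) = X a) (hb : σ (X b) = X b + X a)
    (hg : ∀ q, g q = X a ^ (e24 q).1 * X b ^ (e24 q).2.1 * X c ^ (e24 q).2.2)
    (ρ : ↥(Subgroup.zpowers σ) →* Aut (Spec (CommRingCat.of (MvPolynomial (Fin n) k))))
    (hρ : ∀ γ : ↥(Subgroup.zpowers σ), (ρ γ).hom = Spec.map (CommRingCat.ofHom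
      ((MulSemiringAction.toRingEquiv (↥(Subgroup.zpowers σ)) (MvPolynomial (Fin n) k) γ⁻¹ :
        MvPolynomial (Fin n) k ≃+* MvPolynomial (Fin n) k) :
          MvPolynomial (Fin n) k →+* MvPolynomial (Fin n) k)))
    (hJ : ∀ γ : ↥(Subgroup.zpowers σ),
      (affineBlowup.idealSheaf (Ideal.span (Set.range g))).comap (ρ γ).hom =
        affineBlowup.idealSheaf (Ideal.span (Set.range g))) :
    (D₊ 0) ⊔
      (⨅ γ : ↥(Subgroup.zpowers σ),
        (((affineBlowup.isBlowup (Ideal.span (Set.range g))).liftAction ρ hJ) γ).hom ⁻¹ᵁ (D₊ 16)) ⊔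
      (⨅ γ : ↥(Subgroup.zpowers σ),
        (((affineBlowup.isBlowup (Ideal.span (Set.range g))).liftAction ρ hJ) γ).hom ⁻¹ᵁ (D₊ 23)) = ⊤ := by
  refine top_le_iff.mp fun x _ => ?_
  have hcov : ∀ y : Proj (reesGrading (Ideal.span (Set.range g))), y ∈ (D₊ 0) ⊔ (D₊ 16) ⊔ (D₊ 23) := by
    intro y; rw [iSup_vertexCharts_eq_top k n a b c g hg]; trivial
  by_cases hx0 : x ∈ (D₊ 0)
  · exact Opens.mem_sup.mpr (Or.inl (Opens.mem_sup.mpr (Or.inl hx0)))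
  by_cases hx16 : x ∈ (D₊ 16)
  · -- the whole orbit stays in the `μ₄`-vertex chart
    refine Opens.mem_sup.mpr (Or.inl (Opens.mem_sup.mpr (Or.inr ?_)))
    refine (mem_iInf_opens _ _).mpr fun γ => ?_
    obtain ⟨m, hm⟩ := exists_preimage_vertexChartB_eq k n a b c g σ h0 hb hg ρ hρ hJ γ
    rw [hm]
    exact (mem_basicOpen_conj_iff k n a b c g hg m x hx0).mpr hx16
  · -- the whole orbit stays in the smooth vertex chart
    refine Opens.mem_sup.mpr (Or.inr ?_)
    refine (mem_iInf_opens _ _).mpr fun γ => ?_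
    change (((affineBlowup.isBlowup (Ideal.span (Set.range g))).liftAction ρ hJ) γ).hom.base x ∈ (D₊ 23)
    set y := (((affineBlowup.isBlowup (Ideal.span (Set.range g))).liftAction ρ hJ) γ).hom.base x with hy
    have hy0 : y ∉ (D₊ 0) := by
      intro h
      apply hx0
      have h' : x ∈ (((affineBlowup.isBlowup (Ideal.span (Set.range g))).liftAction ρ hJ) γ).hom ⁻¹ᵁ (D₊ 0) := h
      rwa [preimage_vertexChartA_eq' k n a b c g σ h0 hg ρ hρ hJ γ] at h'
    have hy16 : y ∉ (D₊ 16) := by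
      intro h
      apply hx16
      have h' : x ∈ (((affineBlowup.isBlowup (Ideal.span (Set.range g))).liftAction ρ hJ) γ).hom ⁻¹ᵁ (D₊ 16) := h
      obtain ⟨m, hm⟩ := exists_preimage_vertexChartB_eq k n a b c g σ h0 hb hg ρ hρ hJ γ
      rw [hm] at h'
      exact (mem_basicOpen_conj_iff k n a b c g hg m x hx0).mp h'
    rcases Opens.mem_sup.mp (hcov y) with h | h
    · rcases Opens.mem_sup.mp h with h | h
      · exact absurd h hy0
      · exact absurd h hy16
    · exact h

/-- **`P_T` and `P₂` are stable.** (`ToricExit.preimage_iInf_preimage_eq`) [folklore] -/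
theorem preimage_piece_eq
    (ρ : ↥(Subgroup.zpowers σ) →* Aut (Spec (CommRingCat.of (MvPolynomial (Fin n) k))))
    (hJ : ∀ γ : ↥(Subgroup.zpowers σ),
      (affineBlowup.idealSheaf (Ideal.span (Set.range g))).comap (ρ γ).hom =
        affineBlowup.idealSheaf (Ideal.span (Set.range g)))
    (j : Fin 24) (δ : ↥(Subgroup.zpowers σ)) :
    (((affineBlowup.isBlowup (Ideal.span (Set.range g))).liftAction ρ hJ) δ).hom ⁻¹ᵁ
        (⨅ γ : ↥(Subgroup.zpowers σ),
          (((affineBlowup.isBlowup (Ideal.span (Set.range g))).liftAction ρ hJ) γ).hom ⁻¹ᵁ (D₊ j)) =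
      ⨅ γ : ↥(Subgroup.zpowers σ),
        (((affineBlowup.isBlowup (Ideal.span (Set.range g))).liftAction ρ hJ) γ).hom ⁻¹ᵁ (D₊ j) :=
  ToricExit.preimage_iInf_preimage_eq _ _ δ

/-- **`P_T` and `P₂` are affine** (finite intersections of affine opens of the separated `V`). [folklore] -/
theorem isAffineOpen_piece
    (ρ : ↥(Subgroup.zpowers σ) →* Aut (Spec (CommRingCat.of (MvPolynomial (Fin n) k))))
    (hJ : ∀ γ : ↥(Subgroup.zpowers σ),
      (affineBlowup.idealSheaf (Ideal.span (Set.range g))).comap (ρ γ).hom =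
        affineBlowup.idealSheaf (Ideal.span (Set.range g)))
    (j : Fin 24) :
    IsAffineOpen (⨅ γ : ↥(Subgroup.zpowers σ),
      (((affineBlowup.isBlowup (Ideal.span (Set.range g))).liftAction ρ hJ) γ).hom ⁻¹ᵁ (D₊ j)) :=
  IsAffineOpen.iInf fun _ =>
    (Proj.isAffineOpen_basicOpen (reesGrading (Ideal.span (Set.range g))) (gT j)
      (reesT_mem _ _) one_pos).preimage _

omit [Finite ↥(Subgroup.zpowers σ)] in
/-- `P_T ≤ D₊(x_b⁷ t)`, `P₂ ≤ D₊(x_c²⁸ t)` (the `γ = 1` member). [folklore] -/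
theorem piece_le_vertexChart
    (ρ : ↥(Subgroup.zpowers σ) →* Aut (Spec (CommRingCat.of (MvPolynomial (Fin n) k))))
    (hJ : ∀ γ : ↥(Subgroup.zpowers σ),
      (affineBlowup.idealSheaf (Ideal.span (Set.range g))).comap (ρ γ).hom =
        affineBlowup.idealSheaf (Ideal.span (Set.range g)))
    (j : Fin 24) :
    (⨅ γ : ↥(Subgroup.zpowers σ),
        (((affineBlowup.isBlowup (Ideal.span (Set.range g))).liftAction ρ hJ) γ).hom ⁻¹ᵁ (D₊ j)) ≤ (D₊ j) :=
  ToricExit.iInf_preimage_le _ _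

end Cover

end Z9Peeled

end Summit.ResolutionOfSingularities.ResolutionOfSingularities.Theorems.WildQuotientResolution

end
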